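import Mathlib.RingTheory.Ideal.KrullsHeightTheorem
import Mathlib.RingTheory.Ideal.MinimalPrime.Basic
import Mathlib.RingTheory.Noetherian.Basic
import Mathlib.RingTheory.Spectrum.Prime.Basic
import HarnessLib

/-!
# Functions whose zero locus lies in a normal crossings divisor are monomials times units

Topic: `Literature/AlgebraicGeometry/Resolution`. The local-algebra step by which an embedded
resolution of singularities MONOMIALIZES a function: if `π : W' → W` is a log resolution of
`Z ⊇ V(s)` with `π⁻¹(Z) = E₁ ∪ ⋯ ∪ E_r` a simple normal crossings divisor, then at every point `p`
of `W'` the pull-back `s ∘ π`, whose zero locus lies in `⋃ Eᵢ`, is `unit · ∏ u_{j}^{k_j}` in the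
regular local ring `𝒪_{W',p}`, the `u_j` being the local equations of the `Eᵢ` through `p` (part of
a regular system of parameters, hence prime elements). This is how Hironaka's theorem is quoted
in analysis (Atiyah 1970, "Resolution of singularities and division of distributions", p. 146:
"`f ∘ φ = ε · ∏ yᵢ^{kᵢ}` with `ε` invertible"; Arnold–Gusein-Zade–Varchenko II, Part II §7.3,
proof of Thm. 7.5; Kollár 2007, 3.110 for the ideal-theoretic "monomial part"), and it is pure
commutative algebra:

* `exists_isUnit_mul_prod_pow_of_forall_prime_mem` — in a Noetherian domain `A`, let
  `z₁, …, z_r` be prime elements and `s ≠ 0` such that **every prime ideal containing `s`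
  contains some `zᵢ`** (geometrically: `V(s) ⊆ ⋃ V(zᵢ)` in `Spec A`). Then
  `s = u · ∏ zᵢ^{kᵢ}` with `u` a unit. Proof: if `s` is not a unit, a prime `𝔮` minimal over `(s)`
  has height `≤ 1` (Krull's Hauptidealsatz) and contains some `(zᵢ)`, a non-zero prime, hence of
  height `≥ 1`; so `𝔮 = (zᵢ)`, `zᵢ ∣ s`, and one concludes by Noetherian induction on `(s)`.
* `exists_isUnit_mul_prod_pow_of_subset` — the same with the hypothesis phrased on the prime
  spectrum: `zeroLocus {s} ⊆ ⋃ᵢ zeroLocus {zᵢ}`.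

Everything is proved; no definitions, no named facts.

## References

* M. F. Atiyah, *Resolution of singularities and division of distributions*, Comm. Pure Appl.
  Math. 23 (1970) 145–150, p. 146.
* V. I. Arnold, S. M. Gusein-Zade, A. N. Varchenko, *Singularities of Differentiable Maps II*
  (2012), Part II §7.3. [ArnoldGuseinzadeVarchenko2012]
* J. Kollár, *Lectures on Resolution of Singularities* (2007), 3.110. [Kollar2007]
* H. Matsumura, *Commutative Ring Theory* (1986), Thm. 13.5 (Krull), Thm. 20.1–20.3 (regular
  local rings are UFDs — not used: the normal-crossings hypothesis makes the factorisation
  elementary). [Matsumura1987]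
-/

namespace Literature.AlgebraicGeometry.Resolution

open Ideal

variable {A : Type*} [CommRing A] [IsDomain A] [IsNoetherianRing A] {ι : Type*} [Fintype ι]

/-- **A function whose zero locus lies in a normal crossings divisor is a monomial times a unit.**
In a Noetherian domain, if `z₁, …, z_r` are prime elements and every prime ideal containing
`s ≠ 0` contains some `zᵢ`, then `s = u · ∏ᵢ zᵢ^{kᵢ}` with `u` a unit (Krull's Hauptidealsatz
and Noetherian induction; Atiyah 1970 p. 146, AGV II §7.3, Kollár 2007 3.110 for the geometric
statement it implements). [folklore] -/
theorem exists_isUnit_mul_prod_pow_of_forall_prime_mem [DecidableEq ι] (z : ι → A)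
    (hz : ∀ i, Prime (z i)) {s : A} (hs : s ≠ 0)
    (H : ∀ q : Ideal A, q.IsPrime → s ∈ q → ∃ i, z i ∈ q) :
    ∃ (u : A) (k : ι → ℕ), IsUnit u ∧ s = u * ∏ i, z i ^ k i := by
  -- Noetherian induction on the principal ideal `(s)`
  suffices key : ∀ I : Ideal A, ∀ s : A, I = Ideal.span {s} → s ≠ 0 →
      (∀ q : Ideal A, q.IsPrime → s ∈ q → ∃ i, z i ∈ q) →
      ∃ (u : A) (k : ι → ℕ), IsUnit u ∧ s = u * ∏ i, z i ^ k i from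
    key _ s rfl hs H
  intro I
  induction I using IsNoetherian.induction with
  | hgt I ih =>
    intro s hI hs H
    subst hI
    by_cases hu : IsUnit s
    · exact ⟨s, 0, hu, by simp⟩
    -- a prime minimal over `(s)`; it has height `≤ 1`
    obtain ⟨m, hm, hsm⟩ := Ideal.exists_le_maximal (Ideal.span {s})
      ((Ideal.span_singleton_ne_top) hu)
    haveI := hm.isPrime
    obtain ⟨q, hq, -⟩ := Ideal.exists_minimalPrimes_le hsm
    haveI hqp : q.IsPrime := hq.1.1
    have hsq : s ∈ q := hq.1.2 (Ideal.mem_span_singleton_self s)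
    have hqh : q.height ≤ 1 := Ideal.height_le_one_of_isPrincipal_of_mem_minimalPrimes _ q hq
    -- it contains some `(zᵢ)`, a prime of height `≥ 1`: so `q = (zᵢ)`
    obtain ⟨i, hi⟩ := H q hqp hsq
    haveI hzp : (Ideal.span {z i}).IsPrime := (Ideal.span_singleton_prime (hz i).ne_zero).2 (hz i)
    have hzh : 1 ≤ (Ideal.span {z i}).height :=
      Ideal.one_le_height_span_singleton_of_mem_nonZeroDivisors
        (mem_nonZeroDivisors_of_ne_zero (hz i).ne_zero)
    haveI : (Ideal.span {z i}).FiniteHeight := Ideal.finiteHeight_of_isNoetherianRing _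
    have hqeq : Ideal.span {z i} = q :=
      Ideal.eq_of_le_of_height_le (Ideal.span {z i}) ((Ideal.span_singleton_le_iff_mem _).2 hi)
        (hqh.trans hzh)
    -- hence `zᵢ ∣ s`
    have hdvd : z i ∣ s := by
      rw [← Ideal.mem_span_singleton, hqeq]; exact hsq
    obtain ⟨s', rfl⟩ := hdvd
    have hs' : s' ≠ 0 := right_ne_zero_of_mul hs
    -- `(zᵢ s') < (s')`
    have hlt : Ideal.span {z i * s'} < Ideal.span {s'} := by
      refine lt_of_le_of_ne (Ideal.span_singleton_le_span_singleton.2 (dvd_mul_left _ _)) ?_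
      intro heq
      have hmem : s' ∈ Ideal.span {z i * s'} := heq ▸ Ideal.mem_span_singleton_self s'
      obtain ⟨a, ha⟩ := Ideal.mem_span_singleton'.1 hmem
      have h1 : (a * z i - 1) * s' = 0 := by rw [sub_mul, one_mul, mul_assoc, ha, sub_self]
      rcases mul_eq_zero.1 h1 with h | h
      · exact (hz i).not_unit (IsUnit.of_mul_eq_one_right a (sub_eq_zero.1 h))
      · exact hs' h
    -- induction hypothesis for `s'`
    have H' : ∀ q : Ideal A, q.IsPrime → s' ∈ q → ∃ i, z i ∈ q :=
      fun q hq hs'q => H q hq (q.mul_mem_left _ hs'q)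
    obtain ⟨u, k, huu, hk⟩ := ih _ hlt s' rfl hs' H'
    refine ⟨u, k + (Pi.single i 1 : ι → ℕ), huu, ?_⟩
    calc z i * s' = z i * (u * ∏ j, z j ^ k j) := by rw [← hk]
      _ = u * (z i ^ (1 : ℕ) * ∏ j, z j ^ k j) := by ring
      _ = u * ∏ j, z j ^ (k + (Pi.single i 1 : ι → ℕ)) j := by
          congr 1
          have hsingle : ∏ j, z j ^ (Pi.single i 1 : ι → ℕ) j = z i ^ (1 : ℕ) := by
            rw [Finset.prod_eq_single i (fun j _ hj => by rw [Pi.single_eq_of_ne hj, pow_zero])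
              (fun h => (h (Finset.mem_univ i)).elim), Pi.single_eq_same]
          rw [← hsingle, ← Finset.prod_mul_distrib]
          exact Finset.prod_congr rfl fun j _ => by rw [Pi.add_apply, pow_add, mul_comm]

/-- **Spectral form**: in a Noetherian domain, if `V(s) ⊆ ⋃ᵢ V(zᵢ)` in `Spec A` for prime
elements `zᵢ` and `s ≠ 0`, then `s = u · ∏ᵢ zᵢ^{kᵢ}` with `u` a unit — the algebraic content
of "a function whose zero set lies in the normal crossings divisor `⋃ {zᵢ = 0}` is a monomial in
the `zᵢ` times a unit" (Atiyah 1970 p. 146; AGV II §7.3). [folklore] -/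
theorem exists_isUnit_mul_prod_pow_of_zeroLocus_subset [DecidableEq ι] (z : ι → A)
    (hz : ∀ i, Prime (z i)) {s : A} (hs : s ≠ 0)
    (H : PrimeSpectrum.zeroLocus ({s} : Set A) ⊆ ⋃ i, PrimeSpectrum.zeroLocus ({z i} : Set A)) :
    ∃ (u : A) (k : ι → ℕ), IsUnit u ∧ s = u * ∏ i, z i ^ k i := by
  refine exists_isUnit_mul_prod_pow_of_forall_prime_mem z hz hs fun q hq hsq => ?_
  have hmem : (⟨q, hq⟩ : PrimeSpectrum A) ∈ PrimeSpectrum.zeroLocus ({s} : Set A) := by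
    simpa [PrimeSpectrum.mem_zeroLocus] using hsq
  obtain ⟨i, hi⟩ := Set.mem_iUnion.1 (H hmem)
  exact ⟨i, by simpa [PrimeSpectrum.mem_zeroLocus] using hi⟩

omit [IsNoetherianRing A] in
/-- **Uniqueness of the exponents**: for pairwise non-associated primes `zᵢ`, the exponents in
`s = u · ∏ᵢ zᵢ^{kᵢ}` are determined by `s` (`kᵢ` is the `zᵢ`-adic order of `s`). [folklore] -/
theorem eq_of_isUnit_mul_prod_pow_eq [DecidableEq ι] (z : ι → A)
    (hz : ∀ i, Prime (z i)) (hza : ∀ i j, i ≠ j → ¬ Associated (z i) (z j))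
    {u v : A} (hu : IsUnit u) (hv : IsUnit v) {k l : ι → ℕ}
    (h : u * ∏ i, z i ^ k i = v * ∏ i, z i ^ l i) : k = l := by
  -- compare `zᵢ`-adic valuations: `zᵢ^{kᵢ+1} ∤ u ∏ z^k` but `zᵢ^{min+1}` divides the side with
  -- the larger exponent
  have key : ∀ (u : A) (k : ι → ℕ) (i : ι) (m : ℕ), IsUnit u →
      (z i ^ m ∣ u * ∏ j, z j ^ k j ↔ m ≤ k i) := by
    intro u k i m hu
    constructor
    · intro hdvd
      by_contra hlt
      push Not at hlt
      -- `z i ^ (k i + 1) ∣ u * ∏ z^k`, absurd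
      have h1 : z i ^ (k i + 1) ∣ u * ∏ j, z j ^ k j := (pow_dvd_pow (z i) hlt).trans hdvd
      have h2 : u * ∏ j, z j ^ k j = (u * ∏ j ∈ Finset.univ.erase i, z j ^ k j) * z i ^ k i := by
        rw [mul_assoc, Finset.prod_erase_mul _ _ (Finset.mem_univ i)]
      rw [h2, pow_succ'] at h1
      have h3 : z i ∣ u * ∏ j ∈ Finset.univ.erase i, z j ^ k j :=
        (mul_dvd_mul_iff_right (pow_ne_zero _ (hz i).ne_zero)).1 h1
      rcases (hz i).dvd_or_dvd h3 with h4 | h4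
      · exact (hz i).not_unit (isUnit_of_dvd_unit h4 hu)
      · obtain ⟨j, hj, hji⟩ := (Prime.dvd_finsetProd_iff (hz i) _).1 h4
        have hne : j ≠ i := Finset.ne_of_mem_erase hj
        have h5 : z i ∣ z j := (hz i).dvd_of_dvd_pow hji
        exact hza i j hne.symm (((hz i).irreducible.dvd_irreducible_iff_associated
          (hz j).irreducible).1 h5)
    · intro hle
      exact (pow_dvd_pow (z i) hle).trans
        ((Finset.dvd_prod_of_mem (fun j => z j ^ k j) (Finset.mem_univ i)).trans
          (dvd_mul_left _ _))
  funext i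
  apply le_antisymm
  · exact (key v l i (k i) hv).1 (h ▸ (key u k i (k i) hu).2 le_rfl)
  · exact (key u k i (l i) hu).1 (h.symm ▸ (key v l i (l i) hv).2 le_rfl)

end Literature.AlgebraicGeometry.Resolution
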